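import Summits.NavierStokesRegularity.FluidComputer.AngularGalerkinLadderBasics
import Literature.Analysis.FluidPDE.ClassicalSolutionRescale

/-!
# The angular Galerkin ladder: dilations about the centre commute with the Casimir cut; every rung
# keeps the exact Navier–Stokes scaling (theorems only)

Cell `ns-blowup`, seat `ns-blowup-lean` (g10). LABEL: KERNEL typing hygiene for the vocabulary of
`FluidComputer/AngularGalerkinLadder.lean` (route `Theses/AngularGalerkinLadder.lean`). WHAT THIS IS
NOT: not Navier–Stokes evidence — kinematic identities and the bookkeeping of Leray's rescaling on
the typed rung classes; nothing is asserted about blow-up or about the dynamics of any rung, no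
profile is constructed, no crux is touched.

## Content

§1 DILATIONS `x ↦ u(cx)` commute with the generators, the Casimir and the band defects
(`angGen_comp_smul`, `casimir_comp_smul`, `bandDefect_comp_smul`), so `IsBandLimited L` is
dilation-invariant (`IsBandLimited.comp_smul`) and, for `c ≠ 0`, so is `IsCobandLimited L`
(`IsCobandLimited.comp_smul`, by the change of variables `∫ f(cx) dx = |c|⁻³ ∫ f`). Hence the
Navier–Stokes rescalings `nsRescale c u (t) = c u(c²t, c·)`,
`nsRescaleForce c d (t) = c³ d(c²t, c·)` act slice-wise inside the band-limited /
co-band-limited classes.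

§2 **Every rung keeps the exact Navier–Stokes scaling**: `IsRungSolutionOn.nsRescale` — if
`(u, p, d)` is a rung-`L` solution on the time set `S` with viscosity `ν`, then for every `c > 0`
`(nsRescale c u, nsRescalePressure c p, nsRescaleForce c d)` is a rung-`L` solution on
`(c² ·)⁻¹' S` with the same viscosity (the classical part is the tree's
`IsClassicalNSSolutionOn.nsRescale_holds`, Leray 1934 §20); on `(−∞, 0)` the time set is
invariant (`IsRungSolutionOn.nsRescale_Iio`).

§3 The profile classes are scale-invariant: `isRotatedDSS_nsRescale` (rotated discrete
self-similarity commutes with Leray's rescaling; the rotation is linear), `HasDefectBound.nsRescale`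
(the scale-invariant defect size `ε/(‖x‖ + √−t)³` is preserved exactly), and with the tree's
`HasTypeIDecay.nsRescale`: `IsRungProfile.nsRescale`, `IsWindowProfile`'s rung-profile, DSS-window
and defect clauses are preserved — only the nontriviality normalisation `‖u(−1, x)‖ ≥ δ` moves with
the scale (not restated).

References: [cite: Leray1934, §20] (the rescaling); [cite: ChaeWolf2017, Def. 1.1] (rotated DSS);
[cite: KNSS2009, (1.6)] (Type-I weight); [cite: BullardGellman1954] (isotypic cut).
-/

noncomputable section

namespace Summit.NavierStokesRegularity.FluidComputer

open Set MeasureTheory Filter Topology Function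
open scoped ContDiff RealInnerProductSpace
open Literature.Analysis.FluidPDE

namespace AngularLadder

variable {u g : EuclideanSpace ℝ (Fin 3) → EuclideanSpace ℝ (Fin 3)} {L : ℕ}

/-! ## §1 Dilations commute with the cut -/

/-- **Dilations commute with the rotation generators**: for differentiable `u` and `c : ℝ`,
`J_a (u(c ·))(x) = (J_a u)(cx)` — since `D(u ∘ c·)(x)(e_a × x) = Du(cx)(e_a × (cx))`.
[folklore] -/
theorem angGen_comp_smul (hu : Differentiable ℝ u) (c : ℝ) (a : Fin 3) :
    angGen a (fun x => u (c • x)) = fun x => angGen a u (c • x) := by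
  funext x
  have hd : HasFDerivAt (fun y : EuclideanSpace ℝ (Fin 3) => u (c • y))
      ((fderiv ℝ u (c • x)).comp (c • ContinuousLinearMap.id ℝ (EuclideanSpace ℝ (Fin 3)))) x :=
    (hu (c • x)).hasFDerivAt.comp x ((hasFDerivAt_id x).const_smul c)
  rw [angGen_eq, angGen_eq]
  simp only [hd.fderiv, ContinuousLinearMap.comp_apply, _root_.smul_apply,
    ContinuousLinearMap.id_apply, map_smul]

/-- **Dilations commute with the Casimir** (smooth `u`). [folklore] -/
theorem casimir_comp_smul (hu : ContDiff ℝ ∞ u) (c : ℝ) :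
    casimir (fun x => u (c • x)) = fun x => casimir u (c • x) := by
  funext x
  have h1 : ∀ a : Fin 3, angGen a (angGen a fun y => u (c • y)) =
      fun y => angGen a (angGen a u) (c • y) := fun a => by
    rw [angGen_comp_smul (hu.differentiable (by simp)),
      angGen_comp_smul ((contDiff_angGen hu a).differentiable (by simp))]
  simp only [casimir, h1]

/-- A dilate of a smooth field is smooth. [folklore] -/
theorem contDiff_comp_smul (hu : ContDiff ℝ ∞ u) (c : ℝ) :
    ContDiff ℝ ∞ fun x : EuclideanSpace ℝ (Fin 3) => u (c • x) :=
  hu.comp (contDiff_id.const_smul c)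

/-- **Dilations commute with every band defect** (smooth `u`). [folklore] -/
theorem bandDefect_comp_smul (hu : ContDiff ℝ ∞ u) (c : ℝ) (L : ℕ) :
    bandDefect L (fun x => u (c • x)) = fun x => bandDefect L u (c • x) := by
  induction L with
  | zero => exact casimir_comp_smul hu c
  | succ L ih =>
      funext x
      change casimir (bandDefect L fun y => u (c • y)) x -
          (((L : ℝ) + 1) * ((L : ℝ) + 2)) • bandDefect L (fun y => u (c • y)) x =
        casimir (bandDefect L u) (c • x) - (((L : ℝ) + 1) * ((L : ℝ) + 2)) • bandDefect L u (c • x)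
      rw [ih, casimir_comp_smul (contDiff_bandDefect hu L)]

/-- **Band-limitedness is dilation-invariant**: `u` band-limited of degree `≤ L` ⇒ so is
`x ↦ u(cx)`, for every `c : ℝ`. [folklore] -/
theorem IsBandLimited.comp_smul (hu : IsBandLimited L u) (c : ℝ) :
    IsBandLimited L fun x => u (c • x) := by
  refine ⟨contDiff_comp_smul hu.1 c, fun x => ?_⟩
  rw [bandDefect_comp_smul hu.1]
  exact hu.2 (c • x)

/-- A velocity slice of a Leray rescaling, `x ↦ c • u(cx)`, is band-limited when `u` is.
[folklore] -/
theorem IsBandLimited.smul_comp_smul (hu : IsBandLimited L u) (c c' : ℝ) :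
    IsBandLimited L fun x => c' • u (c • x) :=
  (hu.comp_smul c).smul c'

/-- **Co-band-limitedness is dilation-invariant** (`c ≠ 0`): `g` co-band-limited of degree `L` ⇒
so is `x ↦ g(cx)` — by the change of variables `∫ ⟪g(cx), ψ(x)⟫ dx = |c|⁻³ ∫ ⟪g(y), ψ(y/c)⟫ dy`
and dilation-invariance of the band-limited compactly supported test fields. [folklore] -/
theorem IsCobandLimited.comp_smul (hg : IsCobandLimited L g) {c : ℝ} (hc : c ≠ 0) :
    IsCobandLimited L fun x => g (c • x) := by
  intro ψ hψ hψc
  have hψ' : IsBandLimited L fun y => ψ (c⁻¹ • y) := hψ.comp_smul c⁻¹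
  have hψc' : HasCompactSupport fun y => ψ (c⁻¹ • y) :=
    hψc.comp_homeomorph (Homeomorph.smulOfNeZero c⁻¹ (inv_ne_zero hc))
  have key := hg _ hψ' hψc'
  have hcv := Measure.integral_comp_smul (μ := (volume : Measure (EuclideanSpace ℝ (Fin 3))))
    (fun y => ⟪g y, ψ (c⁻¹ • y)⟫) c
  simp only [smul_smul, inv_mul_cancel₀ hc, one_smul, key, smul_zero] at hcv
  exact hcv

/-- A defect slice of a Leray rescaling, `x ↦ c' • g(cx)`, is co-band-limited when `g` is
(`c ≠ 0`). [folklore] -/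
theorem IsCobandLimited.smul_comp_smul (hg : IsCobandLimited L g) {c : ℝ} (hc : c ≠ 0) (c' : ℝ) :
    IsCobandLimited L fun x => c' • g (c • x) :=
  (hg.comp_smul hc).smul c'

/-! ## §2 Every rung keeps the Navier–Stokes scaling -/

/-- **Rung solutions are covariant under Leray's rescaling**: if `(u, p, d)` is a rung-`L`
solution on `S` (viscosity `ν`), then for `c > 0` the rescaled triple
`(c u(c²t, cx), c² p(c²t, cx), c³ d(c²t, cx))` is a rung-`L` solution on `(c² ·)⁻¹' S` with the
same viscosity — classical part by `IsClassicalNSSolutionOn.nsRescale_holds` (Leray 1934, §20),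
band- and co-band-limitedness of the slices by §1. [folklore] -/
theorem IsRungSolutionOn.nsRescale {S : Set ℝ} {ν : ℝ}
    {v : ℝ → EuclideanSpace ℝ (Fin 3) → EuclideanSpace ℝ (Fin 3)}
    {p : ℝ → EuclideanSpace ℝ (Fin 3) → ℝ}
    {d : ℝ → EuclideanSpace ℝ (Fin 3) → EuclideanSpace ℝ (Fin 3)}
    (h : IsRungSolutionOn S ν L v p d) {c : ℝ} (hc : 0 < c) :
    IsRungSolutionOn ((fun t => c ^ 2 * t) ⁻¹' S) ν L (Literature.Analysis.FluidPDE.nsRescale c v)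
      (nsRescalePressure c p) (nsRescaleForce c d) := by
  refine ⟨IsClassicalNSSolutionOn.nsRescale_holds h.1 hc, fun t ht => ?_, fun t ht => ?_⟩
  · have hb := (h.2.1 (c ^ 2 * t) ht).smul_comp_smul c c
    exact hb
  · have hb := (h.2.2 (c ^ 2 * t) ht).smul_comp_smul hc.ne' (c ^ 3)
    exact hb

/-- On the ancient time set `(−∞, 0)` the rescaled rung solution lives on `(−∞, 0)` again.
[folklore] -/
theorem IsRungSolutionOn.nsRescale_Iio {ν : ℝ}
    {v : ℝ → EuclideanSpace ℝ (Fin 3) → EuclideanSpace ℝ (Fin 3)}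
    {p : ℝ → EuclideanSpace ℝ (Fin 3) → ℝ}
    {d : ℝ → EuclideanSpace ℝ (Fin 3) → EuclideanSpace ℝ (Fin 3)}
    (h : IsRungSolutionOn (Iio 0) ν L v p d) {c : ℝ} (hc : 0 < c) :
    IsRungSolutionOn (Iio 0) ν L (Literature.Analysis.FluidPDE.nsRescale c v)
      (nsRescalePressure c p) (nsRescaleForce c d) := by
  have hS : ((fun t => c ^ 2 * t) ⁻¹' Iio (0 : ℝ)) = Iio 0 := by
    ext t
    simp only [mem_preimage, mem_Iio]
    constructor
    · intro ht
      by_contra hle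
      exact absurd ht (not_lt.2 (mul_nonneg (sq_nonneg c) (not_lt.1 hle)))
    · intro ht
      exact mul_neg_of_pos_of_neg (by positivity) ht
  have key := h.nsRescale hc
  rwa [hS] at key

/-! ## §3 The profile classes are scale-invariant -/

/-- **Rotated discrete self-similarity commutes with Leray's rescaling** (the rotation `R` is
linear, so `R(λx) = λ Rx`). [folklore] -/
theorem isRotatedDSS_nsRescale {c : ℝ}
    {R : EuclideanSpace ℝ (Fin 3) ≃ₗᵢ[ℝ] EuclideanSpace ℝ (Fin 3)}
    {v : ℝ → EuclideanSpace ℝ (Fin 3) → EuclideanSpace ℝ (Fin 3)} (h : IsRotatedDSS c R v)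
    (l : ℝ) : IsRotatedDSS c R (Literature.Analysis.FluidPDE.nsRescale l v) := by
  intro t x
  have key := h (l ^ 2 * t) (l • x)
  rw [map_smul] at key
  have e1 : l ^ 2 * (c ^ 2 * t) = c ^ 2 * (l ^ 2 * t) := by ring
  simp only [nsRescale_apply, map_smul, smul_comm l c (R x), e1]
  rw [smul_comm c l, key]

/-- **The scale-invariant defect bound is preserved exactly by Leray's rescaling of the force**
(`c > 0`): `‖c³ d(c²t, cx)‖ ≤ c³ ε/(‖cx‖ + √(−c²t))³ = ε/(‖x‖ + √−t)³`. [folklore] -/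
theorem HasDefectBound.nsRescale {ε : ℝ}
    {d : ℝ → EuclideanSpace ℝ (Fin 3) → EuclideanSpace ℝ (Fin 3)} (h : HasDefectBound ε d)
    {c : ℝ} (hc : 0 < c) : HasDefectBound ε (nsRescaleForce c d) := by
  intro t ht x
  have hct : c ^ 2 * t < 0 := mul_neg_of_pos_of_neg (by positivity) ht
  have key := h (c ^ 2 * t) hct (c • x)
  have hsq : Real.sqrt (-(c ^ 2 * t)) = c * Real.sqrt (-t) := by
    rw [show -(c ^ 2 * t) = c ^ 2 * -t by ring, Real.sqrt_mul (sq_nonneg c), Real.sqrt_sq hc.le]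
  rw [norm_smul, Real.norm_of_nonneg hc.le, hsq, ← mul_add, mul_pow] at key
  have hden : 0 < ‖x‖ + Real.sqrt (-t) :=
    add_pos_of_nonneg_of_pos (norm_nonneg _) (Real.sqrt_pos.2 (by linarith))
  have hc3 : 0 < c ^ 3 := by positivity
  rw [nsRescaleForce_apply, norm_smul, Real.norm_of_nonneg hc3.le]
  calc c ^ 3 * ‖d (c ^ 2 * t) (c • x)‖
      ≤ c ^ 3 * (ε / (c ^ 3 * (‖x‖ + Real.sqrt (-t)) ^ 3)) := by gcongr
    _ = ε / (‖x‖ + Real.sqrt (-t)) ^ 3 := by field_simp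

/-- **The rung-profile class is scale-invariant**: Leray's rescaling by `l > 0` maps a Type-I
rotated-DSS ancient rung-`L` profile `(u, p, d)` with constants `(C₀, c, R)` to another one with
the SAME constants. [folklore] -/
theorem IsRungProfile.nsRescale {C₀ c : ℝ}
    {R : EuclideanSpace ℝ (Fin 3) ≃ₗᵢ[ℝ] EuclideanSpace ℝ (Fin 3)}
    {v : ℝ → EuclideanSpace ℝ (Fin 3) → EuclideanSpace ℝ (Fin 3)}
    {p : ℝ → EuclideanSpace ℝ (Fin 3) → ℝ}
    {d : ℝ → EuclideanSpace ℝ (Fin 3) → EuclideanSpace ℝ (Fin 3)}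
    (h : IsRungProfile L C₀ c R v p d) {l : ℝ} (hl : 0 < l) :
    IsRungProfile L C₀ c R (Literature.Analysis.FluidPDE.nsRescale l v) (nsRescalePressure l p)
      (nsRescaleForce l d) :=
  ⟨h.1.nsRescale_Iio hl, h.2.1, isRotatedDSS_nsRescale h.2.2.1 l, h.2.2.2.nsRescale hl⟩

end AngularLadder

end Summit.NavierStokesRegularity.FluidComputer

end
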